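import Mathlib
import Literature.Computability.AlgebraicComplexity.AlgDetRepr
import HarnessLib

/-!
# Multiplicativity of `(m, s)`-representations: sizes add, dimensions multiply

Helper file for the pieces `PolySizeQPAlgebra` (stmt-ValiantsHypothesis-8064) and `AbelianizationQP`
(stmt-8063) of route `GrenetZeon`, companion of
`GrenetZeonPolySizeQPAlgebraSumsOfDeterminants.lean` (ADDITIVITY `hasAlgDetRepr_add`:
`(m, s) + (m, s') ↦ (m, s + s')` over `R₁ × R₂`).

Here the multiplicative half of the calculus: if `f = λ₁(det A₁)` over `R₁` (`m₁ × m₁`,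
`dim R₁ ≤ s₁`) and `g = λ₂(det A₂)` over `R₂` (`m₂ × m₂`, `dim R₂ ≤ s₂`), then
`f · g = (λ₁ ⊗ λ₂)(det (A₁ ⊕ A₂))` over `R₁ ⊗ R₂`: an `(m₁ + m₂, s₁ s₂)`-representation.  So the
two-parameter model is closed under sums and products with the bookkeeping of a
quasi-polynomial ΣΠ-calculus (`(m, s)`: `+ ↦ (max, Σ)` after padding, `× ↦ (Σ, Π)`), the mechanism
behind the zeon point (`ℂ[ε]/(ε²)`-factors tensor to the zeon algebra) and behind every
«product of abelianized pieces» construction the crux `AbelianizationQP` might use.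

## Main results

* `hasAlgDetRepr_mul` — `HasAlgDetRepr f m₁ s₁ → HasAlgDetRepr g m₂ s₂ →
  HasAlgDetRepr (f * g) (m₁ + m₂) (s₁ * s₂)`.
* `hasAlgDetRepr_one` — the unit: `1` is a `(0, 1)`-representation.
* `hasAlgDetRepr_finset_prod` — finite products: `(Σ mₐ, Π sₐ)`.
* `hasAlgDetRepr_pow` — powers: `f^e` is a `(e m, s^e)`-representation.

This file is route-independent (no `Theses` import).  No stub of the line is closed; `VP ≠ VNP`
is not touched.

## References

* P. Hrubeš, A. Yehudayoff, *Arithmetic complexity in ring extensions*, Theory of Computing 7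
  (2011), §2 (dimension of a composite of extensions is the product). [cite: HrubesYehudayoff2011, §2]
-/

set_option linter.dupNamespace false

noncomputable section

namespace Summit.ValiantsHypothesis.ValiantsHypothesis.Theorems.GrenetZeonPolySizeQPAlgebra

open MvPolynomial Matrix
open scoped TensorProduct
open Literature.Computability.AlgebraicComplexity

universe u v

section Multiplicativity

variable {K : Type u} [Field K] {σ : Type v}

/-- Pushing an affine matrix along a ring hom keeps it affine. [folklore] -/
theorem totalDegree_mapMatrix_le {R S : Type*} [CommSemiring R] [CommSemiring S] (φ : R →+* S)
    {ι : Type*} [Fintype ι] [DecidableEq ι] (A : Matrix ι ι (MvPolynomial σ R))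
    (hA : ∀ i j, (A i j).totalDegree ≤ 1)
    (i j : ι) : (((MvPolynomial.map φ).mapMatrix A) i j).totalDegree ≤ 1 := by
  rw [RingHom.mapMatrix_apply, Matrix.map_apply]
  exact (Finset.sup_mono (MvPolynomial.support_map_subset φ (A i j))).trans (hA i j)

/-- **Multiplicativity of the model.** If `f` has an `(m₁, s₁)`-representation (over `R₁`, through
`λ₁`) and `g` an `(m₂, s₂)`-representation (over `R₂`, through `λ₂`), then `f · g` has an
`(m₁ + m₂, s₁ s₂)`-representation: over `R₁ ⊗ R₂` (`finrank` multiplies,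
`Module.finrank_tensorProduct`), with the block-diagonal matrix `A₁ ⊕ A₂` (its determinant is
`det A₁ ⊗ det A₂` coefficientwise: `det_fromBlocks_zero₂₁`, `coeff_mul`), read through
`λ₁ ⊗ λ₂` (`TensorProduct.map`, multiplied together by `LinearMap.mul'`). [cite: HrubesYehudayoff2011, §2] -/
theorem hasAlgDetRepr_mul {f g : MvPolynomial σ K} {m₁ m₂ s₁ s₂ : ℕ} (hf : HasAlgDetRepr f m₁ s₁)
    (hg : HasAlgDetRepr g m₂ s₂) : HasAlgDetRepr (f * g) (m₁ + m₂) (s₁ * s₂) := by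
  classical
  obtain ⟨R₁, _, _, _, hR₁, l₁, A₁, hA₁, hf₁⟩ := hf
  obtain ⟨R₂, _, _, _, hR₂, l₂, A₂, hA₂, hf₂⟩ := hg
  let R := R₁ ⊗[K] R₂
  let iL : R₁ →+* R := (Algebra.TensorProduct.includeLeft : R₁ →ₐ[K] R)
  let iR : R₂ →+* R := (Algebra.TensorProduct.includeRight : R₂ →ₐ[K] R)
  let B₁ : Matrix (Fin m₁) (Fin m₁) (MvPolynomial σ R) := (MvPolynomial.map iL).mapMatrix A₁
  let B₂ : Matrix (Fin m₂) (Fin m₂) (MvPolynomial σ R) := (MvPolynomial.map iR).mapMatrix A₂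
  let A : Matrix (Fin (m₁ + m₂)) (Fin (m₁ + m₂)) (MvPolynomial σ R) :=
    Matrix.reindex finSumFinEquiv finSumFinEquiv (Matrix.fromBlocks B₁ 0 0 B₂)
  let l : R →ₗ[K] K := (LinearMap.mul' K K) ∘ₗ (TensorProduct.map l₁ l₂)
  have hl : ∀ (a : R₁) (b : R₂), l (a ⊗ₜ b) = l₁ a * l₂ b := fun a b => by
    show (LinearMap.mul' K K) ((TensorProduct.map l₁ l₂) (a ⊗ₜ[K] b)) = _
    rw [TensorProduct.map_tmul, LinearMap.mul'_apply]
  have hdet : A.det = MvPolynomial.map iL A₁.det * MvPolynomial.map iR A₂.det := by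
    simp only [A, Matrix.det_reindex_self, Matrix.det_fromBlocks_zero₂₁, B₁, B₂, RingHom.map_det]
  refine ⟨R, inferInstance, inferInstance, inferInstance, ?_, l, A, fun i j => ?_, fun d => ?_⟩
  · rw [Module.finrank_tensorProduct]
    exact Nat.mul_le_mul hR₁ hR₂
  · simp only [A, Matrix.reindex_apply, Matrix.submatrix_apply]
    rcases finSumFinEquiv.symm i with a | a <;> rcases finSumFinEquiv.symm j with b | b
    · rw [Matrix.fromBlocks_apply₁₁]; exact totalDegree_mapMatrix_le iL A₁ hA₁ a b
    · rw [Matrix.fromBlocks_apply₁₂, Matrix.zero_apply, totalDegree_zero]; exact Nat.zero_le _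
    · rw [Matrix.fromBlocks_apply₂₁, Matrix.zero_apply, totalDegree_zero]; exact Nat.zero_le _
    · rw [Matrix.fromBlocks_apply₂₂]; exact totalDegree_mapMatrix_le iR A₂ hA₂ a b
  · rw [hdet, coeff_mul, map_sum, coeff_mul]
    refine Finset.sum_congr rfl fun x _ => ?_
    rw [coeff_map, coeff_map, ← hf₁, ← hf₂, ← hl]
    congr 1
    change (coeff x.1 A₁.det ⊗ₜ[K] (1 : R₂)) * ((1 : R₁) ⊗ₜ[K] coeff x.2 A₂.det) = _
    rw [Algebra.TensorProduct.tmul_mul_tmul, mul_one, one_mul]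

/-- The unit of the calculus: the constant `1` is a `(0, 1)`-representation (empty matrix over
`K`). [folklore] -/
theorem hasAlgDetRepr_one : HasAlgDetRepr (1 : MvPolynomial σ K) 0 1 :=
  (hasAlgDetRepr_zero_left_iff le_rfl).mpr ⟨1, C_1.symm⟩

/-- **Finite products**: a product of polynomials with `(mₐ, sₐ)`-representations has a
`(Σ mₐ, Π sₐ)`-representation. [cite: HrubesYehudayoff2011, §2] -/
theorem hasAlgDetRepr_finset_prod {α : Type*} (t : Finset α) (F : α → MvPolynomial σ K)
    (m s : α → ℕ) (h : ∀ a ∈ t, HasAlgDetRepr (F a) (m a) (s a)) :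
    HasAlgDetRepr (∏ a ∈ t, F a) (∑ a ∈ t, m a) (∏ a ∈ t, s a) := by
  classical
  induction t using Finset.induction_on with
  | empty => rw [Finset.prod_empty, Finset.sum_empty, Finset.prod_empty]; exact hasAlgDetRepr_one
  | insert a t hat ih =>
    rw [Finset.prod_insert hat, Finset.sum_insert hat, Finset.prod_insert hat]
    exact hasAlgDetRepr_mul (h a (Finset.mem_insert_self a t))
      (ih fun b hb => h b (Finset.mem_insert_of_mem hb))

/-- **Powers**: `f^e` has an `(e m, s^e)`-representation if `f` has an `(m, s)`-representation.
[cite: HrubesYehudayoff2011, §2] -/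
theorem hasAlgDetRepr_pow {f : MvPolynomial σ K} {m s : ℕ} (h : HasAlgDetRepr f m s) (e : ℕ) :
    HasAlgDetRepr (f ^ e) (e * m) (s ^ e) := by
  have := hasAlgDetRepr_finset_prod (Finset.range e) (fun _ => f) (fun _ => m) (fun _ => s)
    fun _ _ => h
  simpa only [Finset.prod_const, Finset.sum_const, Finset.card_range, smul_eq_mul] using this

end Multiplicativity

end Summit.ValiantsHypothesis.ValiantsHypothesis.Theorems.GrenetZeonPolySizeQPAlgebra

end
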